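import Summits.CriticalPhenomena.CardyFormulaZ2.Theorems.CardyMagicRigidityNestingRigidityTomographyVocab
import HarnessLib

/-!
# The dictionary of neck tomography: glued partitions are open/closed clusters off the collars

Crux `Summit.CriticalPhenomena.CardyFormulaZ2.Theses.CardyMagicRigidity.NestingRigidity` (stmt-CriticalPhenomena-4835),
line `pinch-resampling` v4, stub S10' `stub_neckTomographyV4` (`FiveArmUpperT → FiveArmUpperZ2 → NoNeckRigidity →
NeckHookupCoarseT → NeckHookupCoarseZ2 → LoopLimitZ2Blind → LoopLimitZ2EqT`); companion of the vocabulary module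
`…NestingRigidityTomographyVocab` (p160054: `tSel`, `tInteriors`, `tCollars`, `tState`, `TGerm`, `tGlue`).  Typing note
`S10p-typing-v2.md`, item A4 (dictionary), = the wave-3 probe `probe_tGlue_state_iff`, PROVED here in general form:

* §1 geometry of regions with pairwise disjoint closed collars `Λ_{2 sc x}(x)` (selected radii are `≥ 1`; neighbours of
  the interior lie in the big ball; the collar of a selected region avoids all selected interiors, so a path inside a
  collar is a blob step);
* §2 **`tGlue_iff_reachable` (registered anchor)**: if the state vector `b` records at every selected region the
  colour-`c` hook-up of its collar crossings, then two sites off the closed collars are `c`-glued under `b` iff they are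
  joined by a `c`-path of the full configuration.  ⟸ is a path-following invariant (`tGlue_inv_of_reflTransGen`): a
  `c`-path enters a big ball through its outer layer, reaches the interior only through a GERM (an inner-layer vertex
  annulus-joined to the outer layer) and leaves through a germ; two germs joined through the ball are either joined in
  the annulus (blob step) or, by `TwoCrossingClusters`, hook the region up in colour `c` (`hookedUp_of_pathIn_of_not_pathIn`),
  whence a passage.  Corollaries: the OPEN dictionary for the realised states is unconditional
  (`tGlue_true_tState_iff_reachable`: `tState x = true ↔ THook` by definition); the CLOSED one
  (`tGlue_false_tState_iff_reachable`) is conditional on the displayed disc duality "not open-hooked ↔ closed-hooked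
  under `TPinch`" (exactly one of the two alternating pairs of crossing clusters is joined through the ball — the
  planar input, not proved here; cf. the planarity axiom of `…NestingRigidityBlobGraph`).

Sorry-free; no `Prop` definition is introduced.
-/

noncomputable section

namespace Summit.CriticalPhenomena.CardyFormulaZ2.Cruxes.NestingRigidity.PinchResampling

open Summit.CriticalPhenomena.CardyFormulaZ2.Theses.CardyMagicRigidity
open MeasureTheory Set Relation Literature.Probability.Percolation Literature.Probability.LatticeModels
  Literature.Probability.RandomPlanarGeometry

/-! ## §1 Geometry of regions with disjoint closed collars -/

section Geometry

variable (sc : Site 2 → ℕ) (X : Set (Site 2))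

/-- The hexagonal norm is `1`-Lipschitz along the edges of `𝕋`, centred form. -/
theorem triNorm_sub_le_of_adj {u u' : Site 2} (h : triGraph.Adj u u') (x : Site 2) :
    triNorm (u' - x) ≤ triNorm (u - x) + 1 := by
  have hadj : triGraph.Adj (u - x) (u' - x) := by
    simpa [Site.shift_apply, sub_eq_add_neg] using (triGraph_adj_shift_iff (-x) u u').2 h
  exact triNorm_le_triNorm_add_one_of_adj hadj

/-- A neighbour of a site of the interior `Λ_s(x)` lies in the big ball `Λ_{2s}(x)` (`s ≥ 1`). -/
theorem mem_tBall_two_mul_of_adj {u u' x : Site 2} {s : ℕ} (hs : 1 ≤ s) (hu : u ∈ tBall x s)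
    (h : triGraph.Adj u u') : u' ∈ tBall x (2 * s) := by
  simp only [tBall, mem_setOf_eq] at hu ⊢
  have := triNorm_sub_le_of_adj h x
  push_cast
  omega

/-- A neighbour of a site outside the big ball `Λ_{2s}(x)` lies outside the interior `Λ_s(x)` (`s ≥ 1`). -/
theorem not_mem_tBall_of_adj {u u' x : Site 2} {s : ℕ} (hs : 1 ≤ s) (hu : u ∉ tBall x (2 * s))
    (h : triGraph.Adj u u') : u' ∉ tBall x s := by
  simp only [tBall, mem_setOf_eq, not_le] at hu ⊢
  have := triNorm_sub_le_of_adj h.symm x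
  push_cast at hu
  omega

variable {sc X}

/-- The interior ball lies in the big ball. -/
theorem tBall_subset_tBall_two_mul (x : Site 2) (s : ℕ) : tBall x s ⊆ tBall x (2 * s) := by
  intro v hv
  simp only [tBall, mem_setOf_eq] at hv ⊢
  push_cast
  have := triNorm_nonneg (v - x)
  omega

/-- The interiors lie inside the closed collars. -/
theorem tInteriors_subset_tCollars (ω : SiteConfig (Site 2)) : tInteriors sc X ω ⊆ tCollars sc X ω := by
  intro v hv
  simp only [tInteriors, tCollars, mem_iUnion] at hv ⊢
  obtain ⟨x, hx, hv⟩ := hv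
  exact ⟨x, hx, tBall_subset_tBall_two_mul x (sc x) hv⟩

/-- A site off the closed collars is off every selected big ball. -/
theorem not_mem_tBall_of_not_mem_tCollars {ω : SiteConfig (Site 2)} {v x : Site 2} (hv : v ∉ tCollars sc X ω)
    (hx : x ∈ tSel sc X ω) : v ∉ tBall x (2 * sc x) := fun h ↦
  hv (mem_biUnion (t := fun y ↦ tBall y (2 * sc y)) hx h)

/-- With pairwise disjoint closed collars, a site of one selected big ball is in no other. -/
theorem not_mem_tBall_of_mem_tBall {ω : SiteConfig (Site 2)}
    (hdisj : ∀ x ∈ tSel sc X ω, ∀ y ∈ tSel sc X ω, x ≠ y → Disjoint (tBall x (2 * sc x)) (tBall y (2 * sc y)))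
    {x y u : Site 2} (hx : x ∈ tSel sc X ω) (hy : y ∈ tSel sc X ω) (hxy : x ≠ y) (hu : u ∈ tBall x (2 * sc x)) :
    u ∉ tBall y (2 * sc y) :=
  Set.disjoint_left.1 (hdisj x hx y hy hxy) hu

/-- With pairwise disjoint closed collars, the collar of a selected region avoids all selected interiors. -/
theorem not_mem_tInteriors_of_mem_collar {ω : SiteConfig (Site 2)}
    (hdisj : ∀ x ∈ tSel sc X ω, ∀ y ∈ tSel sc X ω, x ≠ y → Disjoint (tBall x (2 * sc x)) (tBall y (2 * sc y)))
    {x u : Site 2} (hx : x ∈ tSel sc X ω) (hu : u ∈ tBall x (2 * sc x)) (hu' : u ∉ tBall x (sc x)) :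
    u ∉ tInteriors sc X ω := by
  simp only [tInteriors, mem_iUnion, not_exists]
  intro y hy huy
  by_cases hxy : x = y
  · subst hxy; exact hu' huy
  · exact not_mem_tBall_of_mem_tBall hdisj hx hy hxy hu (tBall_subset_tBall_two_mul y (sc y) huy)

/-- Hence a path inside the collar region `Λ_{2s}(x) ∖ Λ_s(x)` of a selected region is a blob step. -/
theorem pathIn_compl_tInteriors_of_pathIn_collar {ω : SiteConfig (Site 2)} {H : SimpleGraph (Site 2)}
    (hdisj : ∀ x ∈ tSel sc X ω, ∀ y ∈ tSel sc X ω, x ≠ y → Disjoint (tBall x (2 * sc x)) (tBall y (2 * sc y)))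
    {x u v : Site 2} (hx : x ∈ tSel sc X ω) (h : PathIn H (tBall x (2 * sc x) \ tBall x (sc x)) u v) :
    PathIn H (tInteriors sc X ω)ᶜ u v :=
  h.mono fun _ hz ↦ not_mem_tInteriors_of_mem_collar hdisj hx hz.1 hz.2

end Geometry

/-! ## §2 The dictionary: glued partitions are reachability (wave-3 probe `probe_tGlue_state_iff`) -/

section Dictionary

variable {sc : Site 2 → ℕ} {X : Set (Site 2)}

/-- Unfolding `tGlue`: the relation is the equivalence closure of "blob step or passage". -/
theorem tGlue_apply_iff (ω : SiteConfig (Site 2)) (c : Bool) (b : Site 2 → Bool) (v w : Site 2) :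
    tGlue sc X ω c b v w ↔ EqvGen (fun v w ↦ PathIn (tColourGraph ω c) (tInteriors sc X ω)ᶜ v w ∨
      ∃ x ∈ tSel sc X ω, b x = c ∧ TGerm sc ω c x v ∧ TGerm sc ω c x w) v w :=
  Iff.rfl

/-- A blob step glues. -/
theorem tGlue_of_pathIn {ω : SiteConfig (Site 2)} {c : Bool} (b : Site 2 → Bool) {v w : Site 2}
    (h : PathIn (tColourGraph ω c) (tInteriors sc X ω)ᶜ v w) : tGlue sc X ω c b v w :=
  EqvGen.rel _ _ (Or.inl h)

/-- A passage through a region hooked in colour `c` glues its `c`-germs. -/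
theorem tGlue_of_passage {ω : SiteConfig (Site 2)} {c : Bool} {b : Site 2 → Bool} {x v w : Site 2}
    (hx : x ∈ tSel sc X ω) (hb : b x = c) (hv : TGerm sc ω c x v) (hw : TGerm sc ω c x w) :
    tGlue sc X ω c b v w :=
  EqvGen.rel _ _ (Or.inr ⟨x, hx, hb, hv, hw⟩)

/-- A path inside a set is a reachability witness. -/
theorem Tomography.reachable_of_pathIn {V : Type*} {H : SimpleGraph V} {A : Set V} {u v : V} (h : PathIn H A u v) :
    H.Reachable u v := by
  rw [SimpleGraph.reachable_iff_reflTransGen]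
  exact Relation.ReflTransGen.mono (r := fun a b ↦ H.Adj a b ∧ b ∈ A) (p := H.Adj) (fun _ _ hab ↦ hab.1) u v h.2

/-- Edges of the colour graph are edges of `𝕋`. -/
theorem triGraph_adj_of_tColourGraph_adj {ω : SiteConfig (Site 2)} {c : Bool} {u v : Site 2}
    (h : (tColourGraph ω c).Adj u v) : triGraph.Adj u v := by
  rw [tColourGraph, siteOpenGraph_adj] at h
  exact h.1

/-- A selected region has exactly two crossing clusters of each colour. -/
theorem twoCrossingClusters_of_mem_tSel {ω : SiteConfig (Site 2)} {x : Site 2} (hx : x ∈ tSel sc X ω) (c : Bool) :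
    TwoCrossingClusters triGraph (tColourGraph ω c) (tBall x (sc x)) (tBall x (2 * sc x)) := by
  have h : TFourArms ω (tBall x (sc x)) (tBall x (2 * sc x)) := hx.2
  cases c
  · exact h.2
  · exact h.1

/-- **The hook-up from one joined pair of separated crossings.**  With exactly two crossing clusters, if two crossings
`a`, `g` are NOT joined inside the annulus but ARE joined inside the big region, then all crossings are pairwise joined
inside the big region (every crossing is annulus-joined to `a` or to `g`). -/
theorem hookedUp_of_pathIn_of_not_pathIn {V : Type*} {G H : SimpleGraph V} {I O : Set V}
    (h2 : TwoCrossingClusters G H I O) {a g : V} (ha : IsCrossing G H I O a) (hg : IsCrossing G H I O g)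
    (hng : ¬ PathIn H (O \ I) a g) (hag : PathIn H O a g) : HookedUp G H I O := by
  have hsub : O \ I ⊆ O := fun _ h ↦ h.1
  have key : ∀ z, IsCrossing G H I O z → PathIn H O a z := by
    intro z hz
    rcases h2.2 a g z ha hg hz with h | h | h
    · exact absurd h hng
    · exact h.mono hsub
    · exact hag.trans (h.mono hsub)
  intro z z' hz hz'
  exact (key z hz).symm.trans (key z' hz')

/-- **Glued ⟹ reachable** (for every state vector whose `c`-passages are hooked in colour `c`). -/
theorem reachable_of_tGlue {ω : SiteConfig (Site 2)} {c : Bool} {b : Site 2 → Bool}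
    (hhook : ∀ x ∈ tSel sc X ω, b x = c → HookedUp triGraph (tColourGraph ω c) (tBall x (sc x)) (tBall x (2 * sc x)))
    {v w : Site 2} (h : tGlue sc X ω c b v w) : (tColourGraph ω c).Reachable v w := by
  rw [tGlue_apply_iff] at h
  induction h with
  | rel v w hr =>
    rcases hr with hp | ⟨x, hx, hb, hv, hw⟩
    · exact Tomography.reachable_of_pathIn hp
    · exact Tomography.reachable_of_pathIn (hhook x hx hb v w hv hw)
  | refl => rfl
  | symm _ _ _ ih => exact ih.symm
  | trans _ _ _ _ _ ih1 ih2 => exact ih1.trans ih2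

/-- **Exit step.**  If `u` lies in the collar of the selected region `y` and carries the collar invariant (it is
annulus-joined to a glued outer/germ vertex, or it is joined inside the big ball to a glued germ through an inner-layer
vertex), and the path now steps to a `c`-neighbour `u'` outside the big ball of `y` and off the interiors, then `u'` is
glued to the start `v`.  (The second case is where the passage is used: the inner-layer vertex is then a germ, and
either it is annulus-joined to the entry germ — a blob step — or the two germs are separated in the annulus and joined
in the ball, which hooks the region up in colour `c`, so its state is `c` and the passage applies.) -/
theorem tGlue_exit {ω : SiteConfig (Site 2)} {c : Bool} {b : Site 2 → Bool}
    (hdisj : ∀ x ∈ tSel sc X ω, ∀ y ∈ tSel sc X ω, x ≠ y → Disjoint (tBall x (2 * sc x)) (tBall y (2 * sc y)))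
    (hhook : ∀ x ∈ tSel sc X ω, HookedUp triGraph (tColourGraph ω c) (tBall x (sc x)) (tBall x (2 * sc x)) → b x = c)
    {v u u' y : Site 2} (hy : y ∈ tSel sc X ω) (hu : u ∈ tBall y (2 * sc y)) (huI : u ∉ tBall y (sc y))
    (hB : (∃ g, tGlue sc X ω c b v g ∧ PathIn (tColourGraph ω c) (tBall y (2 * sc y) \ tBall y (sc y)) g u ∧
        (g ∈ outerLayer triGraph (tBall y (sc y)) (tBall y (2 * sc y)) ∨ TGerm sc ω c y g)) ∨
      (∃ a g', TGerm sc ω c y a ∧ tGlue sc X ω c b v a ∧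
        g' ∈ innerLayer triGraph (tBall y (sc y)) (tBall y (2 * sc y)) ∧
        PathIn (tColourGraph ω c) (tBall y (2 * sc y)) a g' ∧
        PathIn (tColourGraph ω c) (tBall y (2 * sc y) \ tBall y (sc y)) g' u))
    (hadj : (tColourGraph ω c).Adj u u') (hu' : u' ∉ tBall y (2 * sc y)) (hu'S : u' ∉ tInteriors sc X ω) :
    tGlue sc X ω c b v u' := by
  have hvu : tGlue sc X ω c b v u := by
    rcases hB with ⟨g, hvg, hgu, -⟩ | ⟨a, g', ha, hva, hg'in, hag', hg'u⟩
    · exact (tGlue sc X ω c b).trans' hvg (tGlue_of_pathIn b (pathIn_compl_tInteriors_of_pathIn_collar hdisj hy hgu))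
    · -- `u` is on the outer layer, so `g'` is a germ
      have huout : u ∈ outerLayer triGraph (tBall y (sc y)) (tBall y (2 * sc y)) :=
        ⟨⟨hu, huI⟩, u', hu', triGraph_adj_of_tColourGraph_adj hadj⟩
      have hg' : TGerm sc ω c y g' := ⟨hg'in, u, huout, hg'u⟩
      have hag : tGlue sc X ω c b a g' := by
        by_cases hp : PathIn (tColourGraph ω c) (tBall y (2 * sc y) \ tBall y (sc y)) a g'
        · exact tGlue_of_pathIn b (pathIn_compl_tInteriors_of_pathIn_collar hdisj hy hp)
        · exact tGlue_of_passage hy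
            (hhook y hy (hookedUp_of_pathIn_of_not_pathIn (twoCrossingClusters_of_mem_tSel hy c) ha hg' hp hag'))
            ha hg'
      exact (tGlue sc X ω c b).trans' ((tGlue sc X ω c b).trans' hva hag)
        (tGlue_of_pathIn b (pathIn_compl_tInteriors_of_pathIn_collar hdisj hy hg'u))
  refine (tGlue sc X ω c b).trans' hvu (tGlue_of_pathIn b (PathIn.of_adj ?_ hu'S hadj))
  exact not_mem_tInteriors_of_mem_collar hdisj hy hu huI

/-- **The path invariant.**  Along a `c`-path from a site `v` off the closed collars, every vertex `u` satisfies: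
(A) if `u` is off the closed collars it is glued to `v`; (B) if `u` lies in the collar of a selected `x`, either it is
annulus-joined to a glued vertex which is an outer-layer vertex or a germ, or it is joined inside the big ball, through
an inner-layer vertex, to a glued germ (the path came through the interior); (C) if `u` lies in the interior of a
selected `x`, it is joined inside the big ball to a glued germ. -/
theorem tGlue_inv_of_reflTransGen {ω : SiteConfig (Site 2)} {c : Bool} {b : Site 2 → Bool}
    (hdisj : ∀ x ∈ tSel sc X ω, ∀ y ∈ tSel sc X ω, x ≠ y → Disjoint (tBall x (2 * sc x)) (tBall y (2 * sc y)))
    (hhook : ∀ x ∈ tSel sc X ω, HookedUp triGraph (tColourGraph ω c) (tBall x (sc x)) (tBall x (2 * sc x)) → b x = c)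
    {v : Site 2} (hv : v ∉ tCollars sc X ω) {u : Site 2} (h : Relation.ReflTransGen (tColourGraph ω c).Adj v u) :
    (u ∉ tCollars sc X ω → tGlue sc X ω c b v u) ∧
    (∀ x ∈ tSel sc X ω, u ∈ tBall x (2 * sc x) → u ∉ tBall x (sc x) →
      (∃ g, tGlue sc X ω c b v g ∧ PathIn (tColourGraph ω c) (tBall x (2 * sc x) \ tBall x (sc x)) g u ∧
        (g ∈ outerLayer triGraph (tBall x (sc x)) (tBall x (2 * sc x)) ∨ TGerm sc ω c x g)) ∨
      (∃ a g', TGerm sc ω c x a ∧ tGlue sc X ω c b v a ∧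
        g' ∈ innerLayer triGraph (tBall x (sc x)) (tBall x (2 * sc x)) ∧
        PathIn (tColourGraph ω c) (tBall x (2 * sc x)) a g' ∧
        PathIn (tColourGraph ω c) (tBall x (2 * sc x) \ tBall x (sc x)) g' u)) ∧
    (∀ x ∈ tSel sc X ω, u ∈ tBall x (sc x) →
      ∃ a, TGerm sc ω c x a ∧ tGlue sc X ω c b v a ∧ PathIn (tColourGraph ω c) (tBall x (2 * sc x)) a u) := by
  induction h with
  | refl =>
    refine ⟨fun _ ↦ (tGlue sc X ω c b).refl' v, fun x hx hvO _ ↦ ?_, fun x hx hvI ↦ ?_⟩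
    · exact absurd hvO (not_mem_tBall_of_not_mem_tCollars hv hx)
    · exact absurd (tBall_subset_tBall_two_mul x (sc x) hvI) (not_mem_tBall_of_not_mem_tCollars hv hx)
  | @tail u u' _ hadj ih =>
    obtain ⟨hA, hB, hC⟩ := ih
    have hadjT : triGraph.Adj u u' := triGraph_adj_of_tColourGraph_adj hadj
    have hS : tInteriors sc X ω ⊆ tCollars sc X ω := tInteriors_subset_tCollars ω
    -- glue to `u'` when `u'` is off the interiors and out of the big ball of wherever `u` was
    have hglue : u' ∉ tInteriors sc X ω → (∀ y ∈ tSel sc X ω, u ∈ tBall y (2 * sc y) → u' ∉ tBall y (2 * sc y)) →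
        tGlue sc X ω c b v u' := by
      intro hu'S hout
      by_cases huC : u ∈ tCollars sc X ω
      · have huC' := huC
        simp only [tCollars, mem_iUnion] at huC'
        obtain ⟨y, hy, huy⟩ := huC'
        by_cases huI : u ∈ tBall y (sc y)
        · exact absurd (mem_tBall_two_mul_of_adj (one_le_of_mem_tSel sc X hy) huI hadjT) (hout y hy huy)
        · exact tGlue_exit hdisj hhook hy huy huI (hB y hy huy huI) hadj (hout y hy huy) hu'S
      · exact (tGlue sc X ω c b).trans' (hA huC) (tGlue_of_pathIn b (PathIn.of_adj (fun h ↦ huC (hS h)) hu'S hadj))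
    refine ⟨fun hu'C ↦ ?_, fun x hx hu'O hu'I ↦ ?_, fun x hx hu'I ↦ ?_⟩
    · -- (A): `u'` off the closed collars
      exact hglue (fun h ↦ hu'C (hS h)) fun y hy _ ↦ not_mem_tBall_of_not_mem_tCollars hu'C hy
    · -- (B): `u'` in the collar of `x`
      by_cases hux : u ∈ tBall x (2 * sc x)
      · by_cases huI : u ∈ tBall x (sc x)
        · -- coming out of the interior
          obtain ⟨a, ha, hva, hau⟩ := hC x hx huI
          exact Or.inr ⟨a, u', ha, hva, ⟨⟨hu'O, hu'I⟩, u, huI, hadjT.symm⟩, hau.tail hadj hu'O,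
            PathIn.refl ⟨hu'O, hu'I⟩⟩
        · -- moving inside the collar
          rcases hB x hx hux huI with ⟨g, hvg, hgu, hg⟩ | ⟨a, g', ha, hva, hg'in, hag', hg'u⟩
          · exact Or.inl ⟨g, hvg, hgu.tail hadj ⟨hu'O, hu'I⟩, hg⟩
          · exact Or.inr ⟨a, g', ha, hva, hg'in, hag', hg'u.tail hadj ⟨hu'O, hu'I⟩⟩
      · -- entering the big ball through the outer layer: `u'` itself is the glued outer-layer vertex
        have hout : u' ∈ outerLayer triGraph (tBall x (sc x)) (tBall x (2 * sc x)) := ⟨⟨hu'O, hu'I⟩, u, hux, hadjT.symm⟩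
        have hvu' : tGlue sc X ω c b v u' := by
          refine hglue (not_mem_tInteriors_of_mem_collar hdisj hx hu'O hu'I) fun y hy huy ↦ ?_
          have hxy : x ≠ y := fun h ↦ hux (h ▸ huy)
          exact not_mem_tBall_of_mem_tBall hdisj hx hy hxy hu'O
        exact Or.inl ⟨u', hvu', PathIn.refl ⟨hu'O, hu'I⟩, Or.inl hout⟩
    · -- (C): `u'` in the interior of `x`
      have hu'O : u' ∈ tBall x (2 * sc x) := tBall_subset_tBall_two_mul x (sc x) hu'I
      by_cases hux : u ∈ tBall x (2 * sc x)
      · by_cases huI : u ∈ tBall x (sc x)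
        · obtain ⟨a, ha, hva, hau⟩ := hC x hx huI
          exact ⟨a, ha, hva, hau.tail hadj hu'O⟩
        · have huin : u ∈ innerLayer triGraph (tBall x (sc x)) (tBall x (2 * sc x)) := ⟨⟨hux, huI⟩, u', hu'I, hadjT⟩
          rcases hB x hx hux huI with ⟨g, hvg, hgu, hg⟩ | ⟨a, g', ha, hva, -, hag', hg'u⟩
          · -- `u` is a germ: annulus-joined to an outer-layer vertex (directly or through the germ `g`)
            have hgerm : TGerm sc ω c x u := by
              rcases hg with hg | ⟨-, w, hw, hgw⟩
              · exact ⟨huin, g, hg, hgu.symm⟩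
              · exact ⟨huin, w, hw, hgu.symm.trans hgw⟩
            exact ⟨u, hgerm, (tGlue sc X ω c b).trans' hvg
              (tGlue_of_pathIn b (pathIn_compl_tInteriors_of_pathIn_collar hdisj hx hgu)), PathIn.of_adj hux hu'O hadj⟩
          · exact ⟨a, ha, hva, (hag'.trans (hg'u.mono fun _ h ↦ h.1)).tail hadj hu'O⟩
      · exact absurd hu'I (not_mem_tBall_of_adj (one_le_of_mem_tSel sc X hx) hux hadjT)

/-- **Registered anchor — the dictionary (wave-3 probe `probe_tGlue_state_iff`, general form).**  Suppose the closed
collars of the selected regions are pairwise disjoint and the state vector `b` records, at every selected region, the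
colour-`c` hook-up of its collar crossings (`b x = c ↔ HookedUp`).  Then two sites OFF the closed collars are glued in
colour `c` under `b` iff they are joined by a `c`-path of the full configuration.  (⟹: blob steps and hooked passages
are paths.  ⟸: follow the path; it enters a big ball through the outer layer, reaches the interior only through an
inner-layer vertex annulus-joined to the outer layer — a germ —, and leaves again through a germ; two germs joined
through the ball are annulus-joined (blob step) or hook the region up (passage), `tGlue_inv_of_reflTransGen`.)  For
`c = true` and the realised states the hypothesis holds by definition (`tGlue_true_tState_iff_reachable`); for
`c = false` it is the disc duality "not open-hooked ↔ closed-hooked" under `TPinch` (`tGlue_false_tState_iff_reachable`,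
displayed hypothesis).  Dangler sites inside a collar are excluded on purpose. -/
theorem tGlue_iff_reachable : ∀ {sc : Site 2 → ℕ} {X : Set (Site 2)} {ω : SiteConfig (Site 2)} {c : Bool} {b : Site 2 → Bool}, (∀ x ∈ Summit.CriticalPhenomena.CardyFormulaZ2.Cruxes.NestingRigidity.PinchResampling.tSel sc X ω, ∀ y ∈ Summit.CriticalPhenomena.CardyFormulaZ2.Cruxes.NestingRigidity.PinchResampling.tSel sc X ω, x ≠ y → Disjoint (tBall x (2 * sc x)) (tBall y (2 * sc y))) → (∀ x ∈ Summit.CriticalPhenomena.CardyFormulaZ2.Cruxes.NestingRigidity.PinchResampling.tSel sc X ω, (b x = c ↔ HookedUp triGraph (tColourGraph ω c) (tBall x (sc x)) (tBall x (2 * sc x)))) → ∀ {v w : Site 2}, v ∉ Summit.CriticalPhenomena.CardyFormulaZ2.Cruxes.NestingRigidity.PinchResampling.tCollars sc X ω → w ∉ Summit.CriticalPhenomena.CardyFormulaZ2.Cruxes.NestingRigidity.PinchResampling.tCollars sc X ω → (Summit.CriticalPhenomena.CardyFormulaZ2.Cruxes.NestingRigidity.PinchResampling.tGlue sc X ω c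 b v w ↔ (tColourGraph ω c).Reachable v w) := by
  intro sc X ω c b hdisj hhook v w hv hw
  exact ⟨reachable_of_tGlue fun x hx hb ↦ (hhook x hx).1 hb, fun h ↦
    (tGlue_inv_of_reflTransGen hdisj (fun x hx hH ↦ (hhook x hx).2 hH) hv
      ((SimpleGraph.reachable_iff_reflTransGen v w).1 h)).1 hw⟩

/-- **The open dictionary for the realised states (unconditional).**  With pairwise disjoint closed collars, two
sites off the closed collars are open-glued under the realised state vector iff they lie in the same open cluster of
the full configuration. -/
theorem tGlue_true_tState_iff_reachable {ω : SiteConfig (Site 2)}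
    (hdisj : ∀ x ∈ tSel sc X ω, ∀ y ∈ tSel sc X ω, x ≠ y → Disjoint (tBall x (2 * sc x)) (tBall y (2 * sc y)))
    {v w : Site 2} (hv : v ∉ tCollars sc X ω) (hw : w ∉ tCollars sc X ω) :
    tGlue sc X ω true (tState sc X ω) v w ↔ (tColourGraph ω true).Reachable v w :=
  tGlue_iff_reachable hdisj (fun x hx ↦ by simp [tState, hx, THook]) hv hw

/-- **The closed dictionary for the realised states, conditional on disc duality.**  If at every selected region
"not open-hooked" is equivalent to "closed-hooked" (planar duality in the disc `Λ_{2s}(x)` under `TPinch`: of the two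
open and the two closed crossing clusters exactly one pair is joined through the ball — a displayed hypothesis here),
then two sites off the closed collars are closed-glued under the realised states iff they lie in the same closed
cluster. -/
theorem tGlue_false_tState_iff_reachable {ω : SiteConfig (Site 2)}
    (hdisj : ∀ x ∈ tSel sc X ω, ∀ y ∈ tSel sc X ω, x ≠ y → Disjoint (tBall x (2 * sc x)) (tBall y (2 * sc y)))
    (hdual : ∀ x ∈ tSel sc X ω, (ω ∉ THook x x (sc x) (sc x) ↔
      HookedUp triGraph (tColourGraph ω false) (tBall x (sc x)) (tBall x (2 * sc x))))
    {v w : Site 2} (hv : v ∉ tCollars sc X ω) (hw : w ∉ tCollars sc X ω) :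
    tGlue sc X ω false (tState sc X ω) v w ↔ (tColourGraph ω false).Reachable v w :=
  tGlue_iff_reachable hdisj (fun x hx ↦ by simpa [tState, hx] using hdual x hx) hv hw

end Dictionary

end Summit.CriticalPhenomena.CardyFormulaZ2.Cruxes.NestingRigidity.PinchResampling

end
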